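import Mathlib
import HarnessLib.Audit
import Summits.PneNP.PneNP.Theorems.PstarCrossRowsAt

/-!
# The blind free CROSS gate: the product-row toolkit at a LEVEL `c`, part 2 — touch or carrier, rank six, per-constraint packages (O2 / E1; prover-1 g23)

FRONTIER range-avoidance ladder, rung F-N3 (`stmt-PneNP-19007`), cell `pnp-ideate`; restricted-model proof complexity — nothing here bears on `P` versus `NP`.

Continuation of `PstarCrossRowsAt` (rows vanishing on the level set `{u_{e₀} = c}`): `touch_or_carrier_at`, `false_of_third_edge_at` (two private edges and a
third edge of `D e₀` give rank six, killing every non-degenerate product row at any level), `clean_cases`, and the per-constraint packages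
`untouched_of_row_at` / `untouched_or_carrier_at` (a row is clean, or a non-degenerate product `μ₁μ₂` with `q + κ = μ₁μ₂` or `u_{e₀} + (q + κ + c) = μ₁μ₂` — the output shape of `clean_or_nondeg_at` for `g = q + κ`).
Proofs are those of `PstarCrossCaseU2Carrier` / `PstarCrossCaseU2Final` verbatim.
-/

set_option linter.dupNamespace false -- `Summit.PneNP.PneNP.…`: summit = sub-problem name (D-0017 single-conjunct layout)

open Finset Module Literature.Computability.Complexity
open Summit.PneNP.PneNP.Theorems.PstarTyped (Typed)
open Summit.PneNP.PneNP.Theorems.PstarSALevel (varSet BoundaryExpanding SimpleOverlap)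
open Summit.PneNP.PneNP.Theorems.PstarCentreFree (vars_mem_varSet)
open Summit.PneNP.PneNP.Theorems.PstarCubeIdeals (IsAffineFn IsQuadFn)
open Summit.PneNP.PneNP.Theorems.PstarQuadRank (rad)
open Summit.PneNP.PneNP.Theorems.PstarProductRank (qform polar cover mem_cover IsInducedMatching)
open Summit.PneNP.PneNP.Theorems.PstarPathRank (AndAdj polar_basis and_ne andPair_ne)
open Summit.PneNP.PneNP.Theorems.PstarReadSumset (V2)
open Summit.PneNP.PneNP.Theorems.PstarRankRigidityTwo (affine_mul_polar symForm linPart symForm_apply linPart_apply)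
open Summit.PneNP.PneNP.Theorems.PstarRankRigidityFour (classification)
open Summit.PneNP.PneNP.Theorems.PstarRankRigidity (eq_zero_or_eq_of_rank_six)
open Summit.PneNP.PneNP.Theorems.PstarForcing (exists_ne_of_rank_four not_rank_four_of_mul)
open Summit.PneNP.PneNP.Theorems.PstarCoincidenceMatching (finrank_ker_add_le_of_inducedMatching)
open Summit.PneNP.PneNP.Theorems.PstarChordSystem (ChordSystem)
open Summit.PneNP.PneNP.Theorems.PstarChordBridgeTools
open Summit.PneNP.PneNP.Theorems.PstarChordBridge
open Summit.PneNP.PneNP.Theorems.PstarChordBridgeForcing (freeMon gam sys_u_eq qform_add' rank_four_of_wf)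
open Summit.PneNP.PneNP.Theorems.PstarChordBridgeBasis (qDir polarDir)
open Summit.PneNP.PneNP.Theorems.PstarChordBridgeCorner (qDir_add)
open Summit.PneNP.PneNP.Theorems.PstarCrossData (CrossData)
open Summit.PneNP.PneNP.Theorems.PstarCrossSystem
open Summit.PneNP.PneNP.Theorems.PstarCrossCorner (PrivEdge)
open Summit.PneNP.PneNP.Theorems.PstarCrossCasePEmptyToggle (andAdj_priv_iff)
open Summit.PneNP.PneNP.Theorems.PstarCrossCaseU2 (u_add)
open Summit.PneNP.PneNP.Theorems.PstarCrossCaseU2Clean (untouched_of_clean)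
open Summit.PneNP.PneNP.Theorems.PstarCrossProductRow (untouched_of_product_row)
open Summit.PneNP.PneNP.Theorems.PstarCrossProductAlgebra
open Summit.PneNP.PneNP.Theorems.PstarCrossCaseU2Touch (card_J₀_le u_add_single_of_unread unread_of_not_mem_D ne_of_privEdge carrier_or_corner)
open Summit.PneNP.PneNP.Theorems.PstarCrossCaseU2Carrier (carrier_of_polar)
open Summit.PneNP.PneNP.Theorems.PstarCrossCaseU2Final (inducedMatching_three)
open Summit.PneNP.PneNP.Theorems.PstarCrossRowsAt

namespace Summit.PneNP.PneNP.Theorems.PstarCrossRowsAtCarrier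

variable {n m : ℕ}

section

variable (I : LocalMap 4 n m) {r : ℕ} {B : BridgeData n m} {e_p e_q g₀ : Fin m}

/-- **Touch or carrier** (level `c`): with `D e₀ ⊆ {π₁, π₂}` (`π₁` private, `π₂ ∈ D e₀`), a non-degenerate row vanishing on `{u_{e₀} = c}` leaves `π₁`
untouched or has a carrier monomial with one AND variable on `π₁` and one on `π₂`. -/
theorem touch_or_carrier_at (hI : I.IsPure xorAndPred) (hS : SimpleOverlap I) (hB : BoundaryExpanding r I) (hD : CrossData I r B e_p e_q g₀)
    {e₀ : Fin m} (he₀ : e₀ ∈ B.N) {mv : V2} {C : Finset (Fin n)} {G T : Finset (Fin m)} (hTJ : T ⊆ B.J₀ \ B.N) (hGJ : Disjoint G B.J₀)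
    (hGfree : ∀ g ∈ G, ¬ (I.vars g 2 ∈ privs I B.N ∨ I.vars g 3 ∈ privs I B.N))
    (hlin : ∀ (π : Fin m) (s : Fin 4), π ∈ B.J₀ \ B.N → 2 ≤ s.val → qDir I B mv (Pi.single (I.vars π s) 1) = qDir I B mv 0 → I.vars π s ∉ C)
    (hpol : ∀ c d : Fin n, polarDir I B mv (Pi.single c 1) (Pi.single d 1) =
      ((polar T (fun j => I.vars j 2) (fun j => I.vars j 3) + polar (freeMon I B.N G) (fun j => I.vars j 2) (fun j => I.vars j 3) :
        LinearMap.BilinForm (ZMod 2) (Fin n → ZMod 2)) (Pi.single c 1)) (Pi.single d 1))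
    {κ : ZMod 2} {μ₁ μ₂ : (Fin n → ZMod 2) → ZMod 2} (h₁ : IsAffineFn μ₁) (h₂ : IsAffineFn μ₂)
    (hn₁ : ∃ z, μ₁ z ≠ μ₁ 0) (hn₂ : ∃ z, μ₂ z ≠ μ₂ 0) (hn : ∃ z, μ₁ z + μ₁ 0 ≠ μ₂ z + μ₂ 0)
    (hrow : (∀ x, qDir I B mv x + κ = μ₁ x * μ₂ x) ∨ (∀ x, (sys I B).u e₀ x + (qDir I B mv x + κ) = μ₁ x * μ₂ x))
    {c : ZMod 2} (hZ : ∀ x, (sys I B).u e₀ x = c → μ₁ x * μ₂ x = 0)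
    {π₁ π₂ : Fin m} (hπ₁ : PrivEdge I B π₁) (hne : π₁ ≠ π₂) (hπ₂D : π₂ ∈ B.D e₀)
    (hD2 : ∀ j ∈ B.D e₀, j = π₁ ∨ j = π₂) :
    ((I.vars π₁ 2 ∉ C ∧ I.vars π₁ 3 ∉ C) ∧
      ∀ g ∈ G, I.vars g 2 ≠ I.vars π₁ 2 ∧ I.vars g 3 ≠ I.vars π₁ 2 ∧ I.vars g 2 ≠ I.vars π₁ 3 ∧ I.vars g 3 ≠ I.vars π₁ 3) ∨
    ∃ o ∈ freeMon I B.N G, ∃ s s₂ : Fin 4, (s = 2 ∨ s = 3) ∧ (s₂ = 2 ∨ s₂ = 3) ∧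
      ((I.vars o 2 = I.vars π₂ s₂ ∧ I.vars o 3 = I.vars π₁ s) ∨ (I.vars o 2 = I.vars π₁ s ∧ I.vars o 3 = I.vars π₂ s₂)) := by
  classical
  by_cases hoff : ∀ s : Fin 4, (s = 2 ∨ s = 3) → μ₁ (Pi.single (I.vars π₁ s) 1) = μ₁ 0 ∧ μ₂ (Pi.single (I.vars π₁ s) 1) = μ₂ 0
  · exact Or.inl (untouched_of_product_row I hI hS hD he₀ hTJ hGJ hGfree hlin hpol h₁ h₂ hrow hπ₁ hoff)
  · right
    push Not at hoff
    obtain ⟨s₀, hs₀, hne0⟩ := hoff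
    have hv : ¬ (μ₁ (Pi.single (I.vars π₁ s₀) 1) + μ₁ 0 = 0 ∧ μ₂ (Pi.single (I.vars π₁ s₀) 1) + μ₂ 0 = 0) := by
      have e : ∀ a b : ZMod 2, a + b = 0 → a = b := by decide
      exact fun h => hne0 (e _ _ h.1) (e _ _ h.2)
    have hw₀ : I.vars π₁ s₀ = I.vars π₁ 2 ∨ I.vars π₁ s₀ = I.vars π₁ 3 := by
      rcases hs₀ with rfl | rfl
      · exact Or.inl rfl
      · exact Or.inr rfl
    rcases carrier_or_corner h₁ h₂ hn₁ hn₂ hn (v := I.vars π₁ 2) (v' := I.vars π₁ 3) hw₀ hv with ⟨w, hw, b, hb2, hb3, hval⟩ | hcorner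
    · -- `b` is an AND variable of `D e₀`, hence of `π₂`
      have hbD : ∃ j ∈ B.D e₀, I.vars j 2 = b ∨ I.vars j 3 = b := by
        by_contra hno
        push Not at hno
        obtain ⟨hb₁, hb₂⟩ := factors_fixed_off_D_at I hI hS hB hD he₀ h₁ h₂ hn₁ hn₂ hn hZ (z := b) fun j hj => hno j hj
        rw [hb₁, hb₂, CharTwo.add_self_eq_zero, CharTwo.add_self_eq_zero, zero_mul, mul_zero, add_zero] at hval
        exact zero_ne_one hval
      obtain ⟨j, hj, hjb⟩ := hbD
      have hjπ₂ : j = π₂ := by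
        rcases hD2 j hj with h | h
        · exfalso
          rw [h] at hjb
          rcases hjb with h' | h'
          · exact hb2 h'.symm
          · exact hb3 h'.symm
        · exact h
      rw [hjπ₂] at hjb
      obtain ⟨s, hs, hws⟩ : ∃ s : Fin 4, (s = 2 ∨ s = 3) ∧ w = I.vars π₁ s := by
        rcases hw with h | h
        · exact ⟨2, Or.inl rfl, h⟩
        · exact ⟨3, Or.inr rfl, h⟩
      obtain ⟨s₂, hs₂, hbs₂⟩ : ∃ s₂ : Fin 4, (s₂ = 2 ∨ s₂ = 3) ∧ b = I.vars π₂ s₂ := by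
        rcases hjb with h | h
        · exact ⟨2, Or.inl rfl, h.symm⟩
        · exact ⟨3, Or.inr rfl, h.symm⟩
      subst hws
      obtain ⟨o, ho, hoor⟩ := carrier_of_polar I hI hS hD he₀ hTJ hpol h₁ h₂ hrow hπ₁ hs hb2 hb3 hval
      refine ⟨o, ho, s, s₂, hs, hs₂, ?_⟩
      rw [← hbs₂]
      exact hoor
    · exact (corner_false_at I hI hS hD he₀ h₁ h₂ hn₁ hn₂ hn hZ hπ₁ hπ₂D hne.symm hcorner).elim

/-- **A third edge of `D e₀` next to two private ones kills every non-degenerate product row**: the induced matching gives `rank Q_{D e₀} ≥ 6`, so a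
quadratic vanishing on `Z(u₀)` is `0` or `u₀`; a non-degenerate product is neither (it takes the value `1`; `u₀` has rank `≥ 4`). -/
theorem false_of_third_edge_at (hI : I.IsPure xorAndPred) (hS : SimpleOverlap I) (hB : BoundaryExpanding r I) (hD : CrossData I r B e_p e_q g₀)
    {e₀ : Fin m} (he₀ : e₀ ∈ B.N) {μ₁ μ₂ : (Fin n → ZMod 2) → ZMod 2} (h₁ : IsAffineFn μ₁) (h₂ : IsAffineFn μ₂)
    (hn₁ : ∃ z, μ₁ z ≠ μ₁ 0) (hn₂ : ∃ z, μ₂ z ≠ μ₂ 0) (hn : ∃ z, μ₁ z + μ₁ 0 ≠ μ₂ z + μ₂ 0)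
    {c : ZMod 2} (hZ : ∀ x, (sys I B).u e₀ x = c → μ₁ x * μ₂ x = 0)
    {π₁ π₂ j : Fin m} (hπ₁ : PrivEdge I B π₁) (hπ₂ : PrivEdge I B π₂) (h12 : π₁ ≠ π₂) (hπ₁D : π₁ ∈ B.D e₀) (hπ₂D : π₂ ∈ B.D e₀)
    (hj : j ∈ B.D e₀) (hj₁ : j ≠ π₁) (hj₂ : j ≠ π₂) : False := by
  classical
  have hM := inducedMatching_three I hI hS hD he₀ hπ₁ hπ₂ h12 hπ₁D hπ₂D hj hj₁ hj₂
  have hcard : ({π₁, π₂, j} : Finset (Fin m)).card = 3 := by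
    rw [card_insert_of_notMem, card_insert_of_notMem, card_singleton]
    · rw [mem_singleton]; exact fun h => hj₂ h.symm
    · rw [mem_insert, mem_singleton, not_or]; exact ⟨h12, fun h => hj₁ h.symm⟩
  have h6 := finrank_ker_add_le_of_inducedMatching (K := ZMod 2) hM
  rw [hcard] at h6
  have hrank6 : finrank (ZMod 2) (rad (polar (B.D e₀) (fun k => I.vars k 2) (fun k => I.vars k 3))) + 6 ≤
      finrank (ZMod 2) (Fin n → ZMod 2) := by
    unfold PstarQuadRank.rad; omega
  have hu := u_add I B e₀
  have huc := u_add_const I B e₀ c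
  have hZ' : ∀ x, (sys I B).u e₀ x + c = 0 → μ₁ x * μ₂ x = 0 := fun x hx => hZ x (by
    have e : ∀ a b : ZMod 2, a + b = 0 → a = b := by decide
    exact e _ _ hx)
  have hP : IsQuadFn fun x => μ₁ x * μ₂ x := ⟨symForm (linPart h₁) (linPart h₂), affine_mul_polar h₁ h₂⟩
  rcases eq_zero_or_eq_of_rank_six huc hrank6 hP hZ' with h0 | hq
  · obtain ⟨y, hy₁, hy₂⟩ := exists_eq_one_one h₁ h₂ hn₁ hn₂ hn 1 1
    have h := h0 y
    simp only [hy₁, hy₂, mul_one] at h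
    exact one_ne_zero h
  · have hrank4 := rank_four_of_wf I hI hS hB hD.wf (card_J₀_le I hD) he₀
    refine not_rank_four_of_mul hu h₁ h₂ (κ := c) (fun x => ?_) hrank4
    have e : ∀ u p k : ZMod 2, p = u + k → u = p + k := by decide
    exact e _ _ _ (hq x)

/-- A clean row at level `c` is a clean row (with a shifted constant). -/
theorem clean_cases {e₀ : Fin m} {mv : V2} {κ c : ZMod 2}
    (h : (∀ x, qDir I B mv x + κ = 0) ∨ (∀ x, qDir I B mv x + κ = (sys I B).u e₀ x + c)) :
    ∃ κ' : ZMod 2, (∀ x, qDir I B mv x + κ' = 0) ∨ (∀ x, qDir I B mv x + κ' = (sys I B).u e₀ x) := by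
  rcases h with h | h
  · exact ⟨κ, Or.inl h⟩
  · refine ⟨κ + c, Or.inr fun x => ?_⟩
    rw [← add_assoc, h x]
    have e : ∀ a k : ZMod 2, a + k + k = a := by decide
    exact e _ _

/-! ## Per-constraint packages at level `c` -/

/-- A row (clean, or non-degenerate product vanishing on `{u_{e₀} = c}`) of the constraint `(C, G, T)` behind `q_{mv}` does not read a private tree edge
outside `D e₀`. -/
theorem untouched_of_row_at (hI : I.IsPure xorAndPred) (hS : SimpleOverlap I) (hB : BoundaryExpanding r I) (hD : CrossData I r B e_p e_q g₀)
    {e₀ : Fin m} (he₀ : e₀ ∈ B.N) {mv : V2} {C : Finset (Fin n)} {G T : Finset (Fin m)} (hTJ : T ⊆ B.J₀ \ B.N) (hGJ : Disjoint G B.J₀)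
    (hGfree : ∀ g ∈ G, ¬ (I.vars g 2 ∈ privs I B.N ∨ I.vars g 3 ∈ privs I B.N))
    (hlin : ∀ (π : Fin m) (s : Fin 4), π ∈ B.J₀ \ B.N → 2 ≤ s.val → qDir I B mv (Pi.single (I.vars π s) 1) = qDir I B mv 0 → I.vars π s ∉ C)
    (hpol : ∀ c d : Fin n, polarDir I B mv (Pi.single c 1) (Pi.single d 1) =
      ((polar T (fun j => I.vars j 2) (fun j => I.vars j 3) + polar (freeMon I B.N G) (fun j => I.vars j 2) (fun j => I.vars j 3) :
        LinearMap.BilinForm (ZMod 2) (Fin n → ZMod 2)) (Pi.single c 1)) (Pi.single d 1))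
    {κ c : ZMod 2}
    (hrowc : ((∀ x, qDir I B mv x + κ = 0) ∨ (∀ x, qDir I B mv x + κ = (sys I B).u e₀ x + c)) ∨
      ∃ μ₁ μ₂ : (Fin n → ZMod 2) → ZMod 2, IsAffineFn μ₁ ∧ IsAffineFn μ₂ ∧
        (∃ z, μ₁ z ≠ μ₁ 0) ∧ (∃ z, μ₂ z ≠ μ₂ 0) ∧ (∃ z, μ₁ z + μ₁ 0 ≠ μ₂ z + μ₂ 0) ∧
        ((∀ x, qDir I B mv x + κ = μ₁ x * μ₂ x) ∨ (∀ x, (sys I B).u e₀ x + (qDir I B mv x + κ + c) = μ₁ x * μ₂ x)))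
    (hZq : ∀ x, (sys I B).u e₀ x = c → qDir I B mv x + κ = 0)
    {π : Fin m} (hπ : PrivEdge I B π) (hπD : π ∉ B.D e₀) :
    (I.vars π 2 ∉ C ∧ I.vars π 3 ∉ C) ∧ ∀ g ∈ G, I.vars g 2 ≠ I.vars π 2 ∧ I.vars g 3 ≠ I.vars π 2 ∧ I.vars g 2 ≠ I.vars π 3 ∧ I.vars g 3 ≠ I.vars π 3 := by
  rcases hrowc with hclean | ⟨μ₁, μ₂, h₁, h₂, hn₁, hn₂, hn, hrow⟩
  · obtain ⟨κ', hc⟩ := clean_cases I hclean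
    exact untouched_of_clean I hI hS hD he₀ hTJ hGJ hGfree hlin hpol hc hπ
  · rcases hrow with h | h
    · have hZ : ∀ x, (sys I B).u e₀ x = c → μ₁ x * μ₂ x = 0 := fun x hx => by rw [← h x, hZq x hx]
      exact untouched_of_not_mem_D_at I hI hS hB hD he₀ hTJ hGJ hGfree hlin hpol h₁ h₂ hn₁ hn₂ hn (Or.inl h) hZ hπ hπD
    · have h' : ∀ x, (sys I B).u e₀ x + (qDir I B mv x + (κ + c)) = μ₁ x * μ₂ x := fun x => by rw [← add_assoc (qDir I B mv x) κ c]; exact h x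
      have hZ : ∀ x, (sys I B).u e₀ x = c → μ₁ x * μ₂ x = 0 := fun x hx => by
        rw [← h x, hZq x hx, hx]
        have e : ∀ k : ZMod 2, k + (0 + k) = 0 := by decide
        exact e _
      exact untouched_of_not_mem_D_at I hI hS hB hD he₀ hTJ hGJ hGfree hlin hpol h₁ h₂ hn₁ hn₂ hn (Or.inr h') hZ hπ hπD

/-- A row at level `c` of the constraint `(C, G, T)` behind `q_{mv}`, when `D e₀ ⊆ {π₁, π₂}` (`π₁` private, `π₂ ∈ D e₀`): `π₁` is untouched, or `G`
has a carrier with one AND variable on `π₁` and one on `π₂`. -/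
theorem untouched_or_carrier_at (hI : I.IsPure xorAndPred) (hS : SimpleOverlap I) (hB : BoundaryExpanding r I) (hD : CrossData I r B e_p e_q g₀)
    {e₀ : Fin m} (he₀ : e₀ ∈ B.N) {mv : V2} {C : Finset (Fin n)} {G T : Finset (Fin m)} (hTJ : T ⊆ B.J₀ \ B.N) (hGJ : Disjoint G B.J₀)
    (hGfree : ∀ g ∈ G, ¬ (I.vars g 2 ∈ privs I B.N ∨ I.vars g 3 ∈ privs I B.N))
    (hlin : ∀ (π : Fin m) (s : Fin 4), π ∈ B.J₀ \ B.N → 2 ≤ s.val → qDir I B mv (Pi.single (I.vars π s) 1) = qDir I B mv 0 → I.vars π s ∉ C)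
    (hpol : ∀ c d : Fin n, polarDir I B mv (Pi.single c 1) (Pi.single d 1) =
      ((polar T (fun j => I.vars j 2) (fun j => I.vars j 3) + polar (freeMon I B.N G) (fun j => I.vars j 2) (fun j => I.vars j 3) :
        LinearMap.BilinForm (ZMod 2) (Fin n → ZMod 2)) (Pi.single c 1)) (Pi.single d 1))
    {κ c : ZMod 2}
    (hrowc : ((∀ x, qDir I B mv x + κ = 0) ∨ (∀ x, qDir I B mv x + κ = (sys I B).u e₀ x + c)) ∨
      ∃ μ₁ μ₂ : (Fin n → ZMod 2) → ZMod 2, IsAffineFn μ₁ ∧ IsAffineFn μ₂ ∧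
        (∃ z, μ₁ z ≠ μ₁ 0) ∧ (∃ z, μ₂ z ≠ μ₂ 0) ∧ (∃ z, μ₁ z + μ₁ 0 ≠ μ₂ z + μ₂ 0) ∧
        ((∀ x, qDir I B mv x + κ = μ₁ x * μ₂ x) ∨ (∀ x, (sys I B).u e₀ x + (qDir I B mv x + κ + c) = μ₁ x * μ₂ x)))
    (hZq : ∀ x, (sys I B).u e₀ x = c → qDir I B mv x + κ = 0)
    {π₁ π₂ : Fin m} (hπ₁ : PrivEdge I B π₁) (hne : π₁ ≠ π₂) (hπ₂D : π₂ ∈ B.D e₀) (hD2 : ∀ j ∈ B.D e₀, j = π₁ ∨ j = π₂) :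
    ((I.vars π₁ 2 ∉ C ∧ I.vars π₁ 3 ∉ C) ∧
      ∀ g ∈ G, I.vars g 2 ≠ I.vars π₁ 2 ∧ I.vars g 3 ≠ I.vars π₁ 2 ∧ I.vars g 2 ≠ I.vars π₁ 3 ∧ I.vars g 3 ≠ I.vars π₁ 3) ∨
    ∃ o ∈ freeMon I B.N G, ∃ s s₂ : Fin 4, (s = 2 ∨ s = 3) ∧ (s₂ = 2 ∨ s₂ = 3) ∧
      ((I.vars o 2 = I.vars π₂ s₂ ∧ I.vars o 3 = I.vars π₁ s) ∨ (I.vars o 2 = I.vars π₁ s ∧ I.vars o 3 = I.vars π₂ s₂)) := by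
  rcases hrowc with hclean | ⟨μ₁, μ₂, h₁, h₂, hn₁, hn₂, hn, hrow⟩
  · obtain ⟨κ', hc⟩ := clean_cases I hclean
    exact Or.inl (untouched_of_clean I hI hS hD he₀ hTJ hGJ hGfree hlin hpol hc hπ₁)
  · rcases hrow with h | h
    · have hZ : ∀ x, (sys I B).u e₀ x = c → μ₁ x * μ₂ x = 0 := fun x hx => by rw [← h x, hZq x hx]
      exact touch_or_carrier_at I hI hS hB hD he₀ hTJ hGJ hGfree hlin hpol h₁ h₂ hn₁ hn₂ hn (Or.inl h) hZ hπ₁ hne hπ₂D hD2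
    · have h' : ∀ x, (sys I B).u e₀ x + (qDir I B mv x + (κ + c)) = μ₁ x * μ₂ x := fun x => by rw [← add_assoc (qDir I B mv x) κ c]; exact h x
      have hZ : ∀ x, (sys I B).u e₀ x = c → μ₁ x * μ₂ x = 0 := fun x hx => by
        rw [← h x, hZq x hx, hx]
        have e : ∀ k : ZMod 2, k + (0 + k) = 0 := by decide
        exact e _
      exact touch_or_carrier_at I hI hS hB hD he₀ hTJ hGJ hGfree hlin hpol h₁ h₂ hn₁ hn₂ hn (Or.inr h') hZ hπ₁ hne hπ₂D hD2

end

end Summit.PneNP.PneNP.Theorems.PstarCrossRowsAtCarrier
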